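import Summits.BirchSwinnertonDyer.BirchSwinnertonDyer.Theorems.ByReductionTypeAtTwoAdditiveRankZeroResidualV7
import Summits.BirchSwinnertonDyer.BirchSwinnertonDyer.Theorems.ByReductionTypeAtTwoUniformKatoHalfSharpAll
import HarnessLib

/-!
# Crux `AdditiveRankZeroAtTwo` (K4 item 19098): the crux BY NAME from its one-sided residual, v8 — the over-`K` child
# C4″ `AdditivePotMultOverKAtTwo` (item 22618) NEEDED ONLY on the potentially multiplicative curves with REDUCIBLE `E[2]`
# off Kato's member sub-block; the WHOLE irreducible-`E[2]` additive block has the shape {(A) on `S₃`-image, lower half}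
# modulo {2 readings + 1 target} (seat `bsd-2adic-addL2x` GEN 15; sequel of v7; repair-census R-B76)

Cell `bsd-2adic`, rung K4, crux stmt-BirchSwinnertonDyer-19098, split v2.2 (children C1″ 22615, C2″ 22616, C3″ 22617,
C4″ 22618, C5‴ 22619, glue 22620). `--supports 19098 --as helper`. HONEST FRAMING (D-0036/D-0054): an assembly-shaped
CONDITIONAL theorem; every research-grade input is displayed; closes nothing at the `∀`-level; nothing booked; BSD is
not proved by any of this. NO restate of the executed split is asked (record for the planner; D-0152: no re-key).

WHAT v8 CHANGES. v7 (p656665) kept THREE special branches on the potentially multiplicative irreducible curves — (NST′)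
sharp reading; `W^{(−2)}` split with `ord₂ #Ш_an` even via the `+ 1` reading and Cassels–Tate squareness (`hPlus`,
`hAnaM2`, `hLowM2`); `W^{(−1)}` split → over `K` (C4″) — because the Kato-at-`2` readings lose `+ 2` / `+ 1` exactly on the
two split-twist classes. GEN 15's R-B76 analysis identifies that loss as Kato's Thm. 12.5 (3) local term at the ONE
exceptional prime of (12.5.1) and files the sharp bound there as the typed target
`AddKatoTwo.KatoSharpAtTwoAdditiveSplitTwist` (= Kato's printed Conj. 12.10 at that prime; conjecture-grade; p663341),
with the consumer `SemistableKatoTwo.missingUpperBoundAt_of_katoSharp_at` (p663723). Hence v8 = v7 with the potentially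
multiplicative IRREDUCIBLE curves treated UNIFORMLY (any twist class, any parity of `ord₂ #Ш_an`):
upper half ⟸ {(NST′) reading `hNST2` ∨ target `hX`} + (A) (`hAnaMI` on the non-abelian-`ℚ(E[2])` curves; print when
abelian); BSD₂ ⟸ that + the lower half `hLowMI`. The binders `hPlus`, `hAnaM2`, `hLowM2` of v6/v7 DISAPPEAR (subsumed), and
C4″ is restricted to `hQKm8` := C4″ on {potentially multiplicative, `E[2]` REDUCIBLE, NOT ((NST′) ∧ Kato-member side
conditions)} — census: ⊆ the 50 + 13 + (48 − member) reducible classes of the 463; the 158 irreducible split-twist classes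
(128 + 30) leave C4″. `hQKm8_of_additivePotMultOverKAtTwo`: C4″ ⟹ `hQKm8` (verbatim weakening).

Inputs of `additiveRankZeroAtTwo_of_residual_v8`: PRINT {`hGZK`, `hmod`, `hmodN`, `hMilneC`, `hHL`, `hLim2`, `hFW`,
`hCassels`, `hCT`} + READINGS {`hNST2` (D-audit PASS), `hin`, `hinNST` (member readings, D-audit PASS)} + TARGET {`hX`}
+ sibling {`hMult`} + research `∀`-objects {C1″ `hAna`, C2″ `hRest`, C3″ `hLow` (VERBATIM children), (I1M′) `hAnaMI` =
statement (A) on the potentially multiplicative irreducible non-abelian-`ℚ(E[2])` curves, (I3M′) `hLowMI` = the lower half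
over `ℚ` on the potentially multiplicative irreducible curves, (I3M_red) `hLowMred` (v7), (I4⁗) `hQKm8`}. So on the whole
ADDITIVE block the residual reads: {(A) on `S₃`-image (C1″ ∪ I1M′), lower half (C3″ ∪ I3M′ ∪ I3M_red), C2″, C4″|reducible
pot-mult rest} modulo {2 readings, 1 target, PRINT}.

References: [Kato2004Asterisque] Thm. 12.5 (3)(4), (12.5.1) (p. 222), Conj. 12.10 (p. 224), 13.13, Thm. 12.6, §14.14,
Prop. 14.16 (2); [SilvermanATAEC1994] V.5.3, Ex. 5.11; [CoatesSujatha2005] statement (A); [Lim2017FineSelmer] Thm. 3.5;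
[Milne1972ArithmeticAV] Thm. 1; [HoffsteinLuo1997]; [Cassels1965ArithmeticVIII]; [SilvermanAEC2009] X.4.14;
[Miller2011LMS] Def. 1.1. Memo `run/shared/lean/pub/bsd-2adic/addL2x/VERDICT-19098-addL2x-GEN15.md`.
-/

set_option autoImplicit false
set_option linter.dupNamespace false

noncomputable section

open scoped Classical

namespace Summit.BirchSwinnertonDyer.BirchSwinnertonDyer.Theorems.AddKatoTwo

open WeierstrassCurve Literature.NumberTheory.EllipticCurves
  Literature.NumberTheory.EllipticCurves.ModularForms
  Literature.NumberTheory.EllipticCurves.Kato2004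
  Literature.NumberTheory.EllipticCurves.Rank1Residual
  Literature.NumberTheory.EllipticCurves.Rank1Residual.Typed
  Literature.NumberTheory.IwasawaTheory
  Summit.BirchSwinnertonDyer.Rank1Residual Summit.BirchSwinnertonDyer.Rank1Residual.AdditivePotMult
  Summit.BirchSwinnertonDyer.Rank1Residual.X5.AddTwoL2
  Summit.BirchSwinnertonDyer.BirchSwinnertonDyer.Theses.ByReductionTypeAtTwo
  Summit.BirchSwinnertonDyer.BirchSwinnertonDyer.Theorems.SemistableKatoTwo

/-! ## §1 The potentially multiplicative IRREDUCIBLE curves, uniformly (any twist class) -/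

/-- **BSD₂ at a potentially multiplicative ADDITIVE curve with IRREDUCIBLE `E[2]` — any twist class — from statement (A)
and the LOWER half over `ℚ`**, granted the (NST′) reading `hNST2` and the target `hX` (`KatoSharpAtTwoAdditiveSplitTwist`,
Kato's Conj. 12.10 at the exceptional prime): the Kato half by `missingUpperBoundAt_of_katoSharp_at` with the sharp
conclusion from `katoSharpAtTwoAdditive_of_reading_of_splitTwist`; (A) from print when `ℚ(E[2])` is abelian
(`conjA_two_of_isAbelianGalois_divisionField_two`), else from `hAnaMI`; then `missingPPartAt_of_lower_of_upper` +
`bsdp_of_missingPPartAt`. [cite: Kato2004Asterisque, Thm. 12.5 (3) and (12.5.1) (p. 222), Conj. 12.10 (p. 224), 14.14 (p. 243)]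
[cite: CoatesSujatha2005, statement (A)] [cite: Lim2017FineSelmer, §3 Thm. 3.5] [cite: FerreroWashington1979, Theorem]
[cite: Miller2011LMS, §1 and Def. 1.1] -/
theorem addPotMultIrr_bsdp_two_of_target_of_conjA_of_lower
    (hNST2 : Kato2004.rankZero_padicValNat_sha_add_padicValNat_tamagawa_le_at_two_of_noSplitTwistNegOneNegTwo_of_irreducible_of_fineSelmerDual_fg)
    (hX : KatoSharpAtTwoAdditiveSplitTwist)
    (hGZK : rank_eq_analyticRank_of_analyticRank_le_one) (hmod : hasEntireLFunction_rat)
    (hLim2 : Lim2017.thm35_at_two_fineSelmerDual_moduleFinite_of_classicalMuVanishes_of_le_divisionField_four)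
    (hFW : ferreroWashington1979_classicalMuVanishes)
    (hAnaMI : ∀ (W : WeierstrassCurve ℚ) [W.IsElliptic] [W.IsGloballyMinimal], ¬ W.HasCM → W.analyticRank = 0 →
      Addv W 2 → padicValRat 2 W.j < 0 → W.HasIrreducibleModPGaloisRep 2 → ¬ IsAbelianGalois ℚ (W.divisionField 2) →
      ∀ (κ : ZpExtension ℚ 2), κ.IsCyclotomic →
        ∃ (γ : Field.absoluteGaloisGroup ℚ) (D : W.FineSelmerDualData κ γ),
          Module.Finite ℤ_[2] (RestrictScalars ℤ_[2] (IwasawaAlgebra 2) D.X))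
    (hLowMI : ∀ (W : WeierstrassCurve ℚ) [W.IsElliptic] [W.IsGloballyMinimal], ¬ W.HasCM → W.analyticRank = 0 →
      Addv W 2 → padicValRat 2 W.j < 0 → W.HasIrreducibleModPGaloisRep 2 → MissingLowerBoundAt W 2)
    (W : WeierstrassCurve ℚ) [W.IsElliptic] [W.IsGloballyMinimal] (hcm : ¬ W.HasCM) (hr : W.analyticRank = 0)
    (hadd : Addv W 2) (hj : padicValRat 2 W.j < 0) (hirr : W.HasIrreducibleModPGaloisRep 2) : BSDp W 2 := by
  have hA : ∀ (κ : ZpExtension ℚ 2), κ.IsCyclotomic →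
      ∃ (γ : Field.absoluteGaloisGroup ℚ) (D : W.FineSelmerDualData κ γ),
        Module.Finite ℤ_[2] (RestrictScalars ℤ_[2] (IwasawaAlgebra 2) D.X) := by
    by_cases hab : IsAbelianGalois ℚ (W.divisionField 2)
    · haveI := hab
      exact conjA_two_of_isAbelianGalois_divisionField_two hLim2 hFW W
    · exact hAnaMI W hcm hr hadd hj hirr hab
  have hup : MissingUpperBoundAt W 2 :=
    missingUpperBoundAt_of_katoSharp_at hGZK hmod W hr hirr
      (fun hL hfin => katoSharpAtTwoAdditive_of_reading_of_splitTwist hNST2 hX W hcm hadd.1 hadd.2 hirr hA hL hfin)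
  have hr1 : W.analyticRank ≤ 1 := by rw [hr]; exact zero_le_one
  exact bsdp_of_missingPPartAt W 2 hGZK hr1
    (missingPPartAt_of_lower_of_upper W 2 (hLowMI W hcm hr hadd hj hirr) hup)

/-! ## §2 The crux BY NAME, ONE-SIDED (glue v8) -/

/-- **The crux `AdditiveRankZeroAtTwo` (item stmt-BirchSwinnertonDyer-19098; type = the route decl verbatim) from its
ONE-SIDED residual, v8.** Inputs: PRINT {`hGZK`, `hmod`, `hmodN`, `hMilneC`, `hHL`, `hLim2`, `hFW`, `hCassels`, `hCT`} +
READINGS {`hNST2`, `hin`, `hinNST`} + TARGET {`hX` = `KatoSharpAtTwoAdditiveSplitTwist`, Kato's Conj. 12.10 at the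
exceptional prime of (12.5.1)} + the sibling crux `hMult` (`MultiplicativeRankZeroAtTwo`, item 19096) + research `∀`-objects:
C1″ `hAna`, C2″ `hRest`, C3″ `hLow` (VERBATIM children), (I1M′) `hAnaMI` = (A) on the potentially multiplicative
irreducible non-abelian-`ℚ(E[2])` curves, (I3M′) `hLowMI` = the lower half on the potentially multiplicative irreducible
curves, (I3M_red) `hLowMred` = the lower half on the reducible (NST′) member curves, (I4⁗) `hQKm8` = child C4″ RESTRICTED
to {potentially multiplicative, `E[2]` reducible, not ((NST′) ∧ member side conditions)}. Branches: `0 ≤ ord₂ j` → v4's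
potentially-good door; else irreducible → §1; else (NST′) ∧ member conditions → the member door
(`missingUpperBoundAt_two_of_katoMember_two_NST`); else over `K` at the curve (`addPotMult_bsdp_two_of_mult_of_overKC_at`).
Versus v7: the `+ 1`/parity branch (`hPlus`, `hAnaM2`, `hLowM2`) and the twist hypotheses of `hAnaM`/`hLowM` disappear;
C4″'s habitat loses every irreducible curve. Conditional (audit `proof.conditional`); the item is NOT closed.
[cite: Kato2004Asterisque, Thm. 12.5 (3) and (12.5.1) (p. 222), Conj. 12.10 (p. 224), 13.13 (p. 233), Thm. 12.6 (p. 222), §14.14 (p. 243), Prop. 14.16 (2) (p. 244)]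
[cite: SilvermanATAEC1994, Thm. V.5.3 and Exercise 5.11] [cite: CoatesSujatha2005, statement (A)]
[cite: Lim2017FineSelmer, §3 Thm. 3.5] [cite: Milne1972ArithmeticAV, Thm. 1] [cite: HoffsteinLuo1997, Theorem]
[cite: Cassels1965ArithmeticVIII] [cite: SilvermanAEC2009, Thm. X.4.14] [cite: Miller2011LMS, Def. 1.1] -/
theorem additiveRankZeroAtTwo_of_residual_v8
    (hGZK : rank_eq_analyticRank_of_analyticRank_le_one) (hmod : hasEntireLFunction_rat) (hmodN : exists_isNewformOf)
    (hMilneC : Milne1972.bsdQuotient_baseChange_quadratic_anyModel)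
    (hHL : HoffsteinLuo1997_exists_twist_L_one_ne_zero)
    (hLim2 : Lim2017.thm35_at_two_fineSelmerDual_moduleFinite_of_classicalMuVanishes_of_le_divisionField_four)
    (hFW : ferreroWashington1979_classicalMuVanishes)
    (hCassels : bsdRHS_eq_of_isIsogenous) (hCT : exists_casselsTate_pairing (K := ℚ))
    (hNST2 : Kato2004.rankZero_padicValNat_sha_add_padicValNat_tamagawa_le_at_two_of_noSplitTwistNegOneNegTwo_of_irreducible_of_fineSelmerDual_fg)
    (hX : KatoSharpAtTwoAdditiveSplitTwist)
    (hin : Kato2004.exists_memberHullInputs_two)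
    (hinNST : Kato2004.exists_memberHullInputs_two_of_noSplitTwistNegOneNegTwo)
    (hMult : MultiplicativeRankZeroAtTwo)
    (hAna : ∀ (W : WeierstrassCurve ℚ) [W.IsElliptic] [W.IsGloballyMinimal], ¬ W.HasCM → W.analyticRank = 0 →
      Addv W 2 → 0 ≤ padicValRat 2 W.j → ¬ IsAbelianGalois ℚ (W.divisionField 2) →
      ∀ (κ : ZpExtension ℚ 2), κ.IsCyclotomic →
        ∃ (γ : Field.absoluteGaloisGroup ℚ) (D : W.FineSelmerDualData κ γ),
          Module.Finite ℤ_[2] (RestrictScalars ℤ_[2] (IwasawaAlgebra 2) D.X))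
    (hRest : ∀ (W : WeierstrassCurve ℚ) [W.IsElliptic] [W.IsGloballyMinimal], ¬ W.HasCM → W.analyticRank = 0 →
      Addv W 2 → 0 ≤ padicValRat 2 W.j → ¬ W.HasIrreducibleModPGaloisRep 2 →
      ¬ ((∀ (W' : WeierstrassCurve ℚ) [W'.IsElliptic], IsIsogenous W W' → ¬ 2 ^ 2 ∣ W'.torsionOrder) ∧
          (∀ q : ℚ, shaAn W = (q : ℂ) → Even (padicValRat 2 q))) →
      MissingUpperBoundAt W 2)
    (hLow : ∀ (W : WeierstrassCurve ℚ) [W.IsElliptic] [W.IsGloballyMinimal], ¬ W.HasCM → W.analyticRank = 0 →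
      Addv W 2 → 0 ≤ padicValRat 2 W.j → MissingLowerBoundAt W 2)
    (hAnaMI : ∀ (W : WeierstrassCurve ℚ) [W.IsElliptic] [W.IsGloballyMinimal], ¬ W.HasCM → W.analyticRank = 0 →
      Addv W 2 → padicValRat 2 W.j < 0 → W.HasIrreducibleModPGaloisRep 2 → ¬ IsAbelianGalois ℚ (W.divisionField 2) →
      ∀ (κ : ZpExtension ℚ 2), κ.IsCyclotomic →
        ∃ (γ : Field.absoluteGaloisGroup ℚ) (D : W.FineSelmerDualData κ γ),
          Module.Finite ℤ_[2] (RestrictScalars ℤ_[2] (IwasawaAlgebra 2) D.X))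
    (hLowMI : ∀ (W : WeierstrassCurve ℚ) [W.IsElliptic] [W.IsGloballyMinimal], ¬ W.HasCM → W.analyticRank = 0 →
      Addv W 2 → padicValRat 2 W.j < 0 → W.HasIrreducibleModPGaloisRep 2 → MissingLowerBoundAt W 2)
    (hLowMred : ∀ (W : WeierstrassCurve ℚ) [W.IsElliptic] [W.IsGloballyMinimal], ¬ W.HasCM → W.analyticRank = 0 →
      Addv W 2 → padicValRat 2 W.j < 0 →
      (∀ d : ℚ, d = -1 ∨ d = -2 → ¬ (W.quadraticTwist d).HasSplitMultiplicativeReductionAtPrime 2) →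
      ¬ W.HasIrreducibleModPGaloisRep 2 →
      ((∀ (W' : WeierstrassCurve ℚ) [W'.IsElliptic], IsIsogenous W W' → ¬ 2 ^ 2 ∣ W'.torsionOrder) ∧
          (∀ q : ℚ, shaAn W = (q : ℂ) → Even (padicValRat 2 q))) → MissingLowerBoundAt W 2)
    (hQKm8 : ∀ (W : WeierstrassCurve ℚ) [W.IsElliptic] [W.IsGloballyMinimal], ¬ W.HasCM → W.analyticRank = 0 →
      Addv W 2 → padicValRat 2 W.j < 0 → ¬ W.HasIrreducibleModPGaloisRep 2 →
      ¬ ((∀ d : ℚ, d = -1 ∨ d = -2 → ¬ (W.quadraticTwist d).HasSplitMultiplicativeReductionAtPrime 2) ∧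
          ((∀ (W' : WeierstrassCurve ℚ) [W'.IsElliptic], IsIsogenous W W' → ¬ 2 ^ 2 ∣ W'.torsionOrder) ∧
            (∀ q : ℚ, shaAn W = (q : ℂ) → Even (padicValRat 2 q)))) →
      ∀ (K : Type) [Field K] [NumberField K], Module.finrank ℚ K = 2 →
        SemistableTwistAtTwo W K → (W.quadraticTwist (NumberField.discr K : ℚ)).entireLFunction 1 ≠ 0 →
          MissingPPartOverCAt (W.baseChange K) 2) :
    Summit.BirchSwinnertonDyer.BirchSwinnertonDyer.Theses.ByReductionTypeAtTwo.AdditiveRankZeroAtTwo := by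
  unfold Summit.BirchSwinnertonDyer.BirchSwinnertonDyer.Theses.ByReductionTypeAtTwo.AdditiveRankZeroAtTwo
  intro W _ _ hcm hr hadd
  haveI : Fact (Nat.Prime 2) := ⟨Nat.prime_two⟩
  by_cases hj : 0 ≤ padicValRat 2 W.j
  · exact addPotGood_bsdp_two_of_kato_of_lower hGZK hmod hmodN hLim2 hFW hCassels hCT
      (katoAtTwoSharp_of_katoAtTwoNST' hNST2) hin hAna hRest hLow W hcm hr hadd hj
  · have hj' : padicValRat 2 W.j < 0 := lt_of_not_ge hj
    by_cases hirr : W.HasIrreducibleModPGaloisRep 2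
    · exact addPotMultIrr_bsdp_two_of_target_of_conjA_of_lower hNST2 hX hGZK hmod hLim2 hFW hAnaMI hLowMI W hcm hr
        hadd hj' hirr
    · by_cases hsub : (∀ d : ℚ, d = -1 ∨ d = -2 →
          ¬ (W.quadraticTwist d).HasSplitMultiplicativeReductionAtPrime 2) ∧
          ((∀ (W' : WeierstrassCurve ℚ) [W'.IsElliptic], IsIsogenous W W' → ¬ 2 ^ 2 ∣ W'.torsionOrder) ∧
            (∀ q : ℚ, shaAn W = (q : ℂ) → Even (padicValRat 2 q)))
      · have hr1 : W.analyticRank ≤ 1 := by rw [hr]; exact zero_le_one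
        exact bsdp_of_missingPPartAt W 2 hGZK hr1
          (missingPPartAt_of_lower_of_upper W 2 (hLowMred W hcm hr hadd hj' hsub.1 hirr hsub.2)
            (missingUpperBoundAt_two_of_katoMember_two_NST hmodN hinNST hLim2 hFW hCassels hCT hGZK hmod W hcm hadd.1
              hadd.2 hsub.1 hirr hr hsub.2.1 hsub.2.2))
      · exact addPotMult_bsdp_two_of_mult_of_overKC_at hGZK hmod hMilneC hHL hMult W hcm hr hadd hj'
          (hQKm8 W hcm hr hadd hj' hirr hsub)

/-- **C4″ ⟹ its restriction (I4⁗)**: the executed child `AdditivePotMultOverKAtTwo` (item 22618) implies the v8 binder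
`hQKm8` (a verbatim weakening: extra hypotheses are dropped). Recorded so the planner sees that v8 consumes nothing beyond
the filed split. [cite: Milne1972ArithmeticAV, Thm. 1] -/
theorem hQKm8_of_additivePotMultOverKAtTwo (h : AdditivePotMultOverKAtTwo) :
    ∀ (W : WeierstrassCurve ℚ) [W.IsElliptic] [W.IsGloballyMinimal], ¬ W.HasCM → W.analyticRank = 0 →
      Addv W 2 → padicValRat 2 W.j < 0 → ¬ W.HasIrreducibleModPGaloisRep 2 →
      ¬ ((∀ d : ℚ, d = -1 ∨ d = -2 → ¬ (W.quadraticTwist d).HasSplitMultiplicativeReductionAtPrime 2) ∧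
          ((∀ (W' : WeierstrassCurve ℚ) [W'.IsElliptic], IsIsogenous W W' → ¬ 2 ^ 2 ∣ W'.torsionOrder) ∧
            (∀ q : ℚ, shaAn W = (q : ℂ) → Even (padicValRat 2 q)))) →
      ∀ (K : Type) [Field K] [NumberField K], Module.finrank ℚ K = 2 →
        SemistableTwistAtTwo W K → (W.quadraticTwist (NumberField.discr K : ℚ)).entireLFunction 1 ≠ 0 →
          MissingPPartOverCAt (W.baseChange K) 2 := by
  intro W _ _ hcm hr hadd hj _ _ K _ _ hK hst hL
  exact h W hcm hr hadd hj K hK hst hL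

end Summit.BirchSwinnertonDyer.BirchSwinnertonDyer.Theorems.AddKatoTwo

end
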